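import Summits.HodgeConjecture.HodgeConjecture.Theorems.AnchorTransportVariationalHodgeDominance
import Literature.NumberTheory.Transcendental.AnalytificationSeparatedProofs
import Literature.AlgebraicGeometry.Motives.AlgPointsProofs
import Mathlib.Topology.Baire.Lemmas
import Mathlib.Topology.Baire.LocallyCompactRegular

/-!
# Route AnchorTransport — `VariationalHodge` (stmt-HodgeConjecture-1076): Zariski-closed sets of complex points with non-empty analytic interior are everything; smooth bases are thick

Two inputs of the crux lines on `AnchorTransport.VariationalHodge`, PROVED on the tree's carriers
granted only Mumford's lemma (`Motives.mumford_smoothCurve_through_two_points`, a named fact):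

* `AnalyticInteriorForcesAll` (idea card `cusp-driven-log-transport`, whose glue is
  `AnalyticInteriorForcesAll → CuspDrivenOpenness → VariationalHodge`): on a smooth irreducible
  `ℂ`-scheme `S`, a set of complex points cut out by a Zariski-closed subset of `S` and having NON-EMPTY
  INTERIOR in the analytic topology of `S(ℂ)` is all of `S(ℂ)` —
  `eq_univ_of_isClosed_of_interior_setOf_pt_mem_nonempty` (affine `S`) and
  `eq_univ_of_isClosed_of_interior_nonempty_of_irreducible` (every smooth irreducible `S`);
  equivalently proper Zariski-closed subsets have complex points with EMPTY INTERIOR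
  (`interior_setOf_pt_mem_eq_empty_of_ne_univ`), the smooth AFFINE analogue of the tree's
  `interior_setOf_pt_mem_eq_empty` for smooth PROJECTIVE varieties (`ZariskiClosedNowhereDense`, via
  GAGA straightening). Proof WITHOUT straightening: a proper closed `Z` misses a complex point `t`;
  join a complex point `u` of the interior to `t` by a smooth irreducible affine curve `g : C ⟶ S`
  (Mumford); `g⁻¹ Z` is a proper closed subset of the curve, hence finite with finitely many complex
  points over it (`AnchorTransportVariationalHodgeCurveThickness`), yet it contains the non-empty
  analytic open `g(ℂ)⁻¹(interior)` of `C(ℂ)`, which is uncountable (`not_countable_of_isOpen_complexPoints`: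
  non-empty opens of the `2m`-manifold `C(ℂ)` are uncountable).
* THICKNESS of smooth irreducible affine bases — the hypothesis `hthick` of
  `variationalHodge_closing_iff` (`AnchorTransportVariationalHodgeClosing`) and `hΛ` of the closing lemma
  for `Λ` with non-empty interior: `S(ℂ)` is a Baire space (locally compact Hausdorff:
  `locallyCompactSpace_algPoints_holds`, `ComplexPoints.t2Space_of_isSeparated`), and the complex points
  of proper Zariski-closed subsets are closed nowhere dense, so no countable union of them contains a
  set with non-empty interior — `not_subset_iUnion_of_interior_nonempty`, `univ_not_subset_iUnion`.
-/

noncomputable section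

-- every declaration of this problem lives in `Summit.HodgeConjecture.HodgeConjecture.…` (summit = sub-problem)
set_option linter.dupNamespace false

open CategoryTheory AlgebraicGeometry TopologicalSpace
open Literature.AlgebraicGeometry.Motives Literature.AlgebraicGeometry.HodgeTheory

namespace Summit.HodgeConjecture.HodgeConjecture.Theorems

/-! ### Non-empty analytic opens of `X(ℂ)` are uncountable -/

/-- **Non-empty open subsets of the complex points of a `ℂ`-scheme smooth of positive relative
dimension are uncountable**: a chart of the `2n`-manifold `X(ℂ)` (`Motives.ComplexPoints.chartedSpace`)
maps the trace of the open set on its source onto a non-empty open subset of `ℝ²ⁿ`, `2n ≥ 2`, and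
countable subsets of a non-trivial real vector space have dense complement
(Mathlib `Set.Countable.dense_compl`). [cite: SerreGAGA1956, §2 n°5 Prop. 2 and n°6] -/
theorem not_countable_of_isOpen_complexPoints {n : ℕ} (X : SchemeOver ℂ) [LocallyOfFiniteType X.hom]
    [SmoothOfRelativeDimension n X.hom] (hn : 1 ≤ n) {W : Set (ComplexPoints X)} (hW : IsOpen W)
    (hWne : W.Nonempty) : ¬ W.Countable := by
  intro hc
  letI := ComplexPoints.chartedSpace X n
  obtain ⟨P, hP⟩ := hWne
  set e := chartAt (EuclideanSpace ℝ (Fin (2 * n))) P with he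
  -- the image of `e.source ∩ W` is a countable non-empty open subset of `ℝ²ⁿ`
  have hopen : IsOpen (e '' (e.source ∩ W)) := e.isOpen_image_source_inter hW
  have hcount : (e '' (e.source ∩ W)).Countable := (hc.mono Set.inter_subset_right).image _
  have hne : (e '' (e.source ∩ W)).Nonempty := ⟨e P, P, ⟨mem_chart_source _ P, hP⟩, rfl⟩
  haveI : Nonempty (Fin (2 * n)) := ⟨⟨0, by omega⟩⟩
  haveI : Nontrivial (EuclideanSpace ℝ (Fin (2 * n))) := inferInstance
  obtain ⟨v, hvt, hvc⟩ := (hcount.dense_compl ℝ).inter_open_nonempty _ hopen hne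
  exact hvc hvt

/-! ### Proper Zariski-closed subsets of a smooth affine `S` have complex points with empty interior -/

/-- **Complex points of a proper Zariski-closed subset have empty analytic interior** (smooth
irreducible AFFINE `S`, granted Mumford's lemma `hM`). If the interior of `Z(ℂ) = {t | pt t ∈ Z}`
contained a complex point `u`, join `u` to a complex point `t` off `Z` (`Z ≠ S`) by a smooth irreducible
affine curve `g : C ⟶ S`; then `g⁻¹ Z ⊊ C` is a proper closed subset of a curve, hence finite, with
finitely many complex points over it, containing the non-empty open `g(ℂ)⁻¹(interior Z(ℂ))` of
`C(ℂ)`, which is uncountable (`not_countable_of_isOpen_complexPoints`). The smooth-affine analogue of the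
projective `interior_setOf_pt_mem_eq_empty` of `ZariskiClosedNowhereDense`, proved here without GAGA
straightening. [cite: MumfordAV1970, §6, Lemma] -/
theorem interior_setOf_pt_mem_eq_empty_of_ne_univ (hM : mumford_smoothCurve_through_two_points)
    {S : SchemeOver ℂ} [IsAffine S.left] [IrreducibleSpace S.left] [AlgebraicGeometry.Smooth S.hom]
    {Z : Set S.left} (hZc : IsClosed Z) (hZ : Z ≠ Set.univ) :
    interior {t : ComplexPoints S | t.pt ∈ Z} = ∅ := by
  by_contra hint
  obtain ⟨u, hu⟩ := Set.nonempty_iff_ne_empty.2 hint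
  -- a complex point off `Z`
  obtain ⟨t, ht⟩ : ∃ t : ComplexPoints S, t.pt ∈ Zᶜ :=
    exists_complexPoints_pt_mem_of_isOpen hZc.isOpen_compl
      (Set.nonempty_compl.2 hZ)
  have huZ : u.pt ∈ Z := interior_subset (s := {t : ComplexPoints S | t.pt ∈ Z}) hu
  have hut : u ≠ t := fun h => ht (h ▸ huZ)
  -- a smooth irreducible affine curve through `u` and `t`
  obtain ⟨C, g, u', t', hCaff, hCirr, hCsm, hCdim, rfl, rfl⟩ := hM.of_irreducibleSpace u t hut
  haveI := hCaff
  haveI := hCirr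
  haveI := hCsm
  haveI : IsLocallyNoetherian C.left := LocallyOfFiniteType.isLocallyNoetherian C.hom
  haveI : CompactSpace C.left := isCompact_univ_iff.mp (isAffineOpen_top C.left).isCompact
  haveI : IsNoetherian C.left := {}
  haveI : ConnectedSpace (ComplexPoints C) := (ComplexPoints.connectedSpace_iff_holds C).2 inferInstance
  obtain ⟨m, hm⟩ := exists_smoothOfRelativeDimension_of_connectedSpace_complexPoints C
  haveI := hm
  have hm1 : 1 ≤ m := by
    have h := topologicalKrullDim_eq_of_smoothOfRelativeDimension C.hom m
    rw [hCdim] at h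
    have : (1 : WithBot ℕ∞) ≤ m := h.le
    exact_mod_cast this
  -- `g⁻¹ Z` is a proper closed subset of the curve `C`, hence has finitely many complex points
  have hZ' : IsClosed (g.left.base ⁻¹' Z) := hZc.preimage g.left.base.hom.continuous
  have hZ'ne : g.left.base ⁻¹' Z ≠ Set.univ := fun h => ht (show (AlgPoints.map g t').pt ∈ Z from
    (h ▸ Set.mem_univ t'.pt : t'.pt ∈ g.left.base ⁻¹' Z))
  have hfin : {c : ComplexPoints C | c.pt ∈ g.left.base ⁻¹' Z}.Finite :=
    finite_setOf_pt_mem (finite_of_isClosed_ne_univ_of_topologicalKrullDim_le_one hCdim.le hZ' hZ'ne)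
  -- … but it contains the non-empty open `g(ℂ)⁻¹ (interior Z(ℂ))`
  have hWopen : IsOpen (AlgPoints.map g ⁻¹' interior {t : ComplexPoints S | t.pt ∈ Z}) :=
    isOpen_interior.preimage (AlgPoints.continuous_map g)
  have hWsub : AlgPoints.map g ⁻¹' interior {t : ComplexPoints S | t.pt ∈ Z} ⊆
      {c : ComplexPoints C | c.pt ∈ g.left.base ⁻¹' Z} := fun c hc =>
    (interior_subset (s := {t : ComplexPoints S | t.pt ∈ Z}) hc : (AlgPoints.map g c).pt ∈ Z)
  exact not_countable_of_isOpen_complexPoints C hm1 hWopen ⟨u', hu⟩ ((hfin.subset hWsub).countable)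

/-- **`AnalyticInteriorForcesAll`, affine case**: on a smooth irreducible affine `ℂ`-scheme `S`
(granted Mumford's lemma), a set of complex points cut out by a Zariski-closed `Z ⊆ S` with non-empty
analytic interior is all of `S(ℂ)` — indeed `Z = S`. [cite: MumfordAV1970, §6, Lemma] -/
theorem eq_univ_of_isClosed_of_interior_setOf_pt_mem_nonempty
    (hM : mumford_smoothCurve_through_two_points) {S : SchemeOver ℂ} [IsAffine S.left]
    [IrreducibleSpace S.left] [AlgebraicGeometry.Smooth S.hom] {Z : Set S.left} (hZc : IsClosed Z)
    (hint : (interior {t : ComplexPoints S | t.pt ∈ Z}).Nonempty) : Z = Set.univ := by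
  by_contra hZ
  exact hint.ne_empty (interior_setOf_pt_mem_eq_empty_of_ne_univ hM hZc hZ)

/-- **`AnalyticInteriorForcesAll` over every smooth irreducible base**: for a smooth irreducible
`ℂ`-scheme `S` (granted Mumford's lemma) and a Zariski-closed `Z ⊆ S`, if `{t ∈ S(ℂ) | pt t ∈ Z}` has
non-empty interior in `S(ℂ)` then `Z = S` (so the set is all of `S(ℂ)`). Reduction to the affine case:
a point `u` of the interior lies over an affine open `W`; the complex points of the open subscheme `W`
map continuously into `S(ℂ)`, so the preimage of the interior is a non-empty open subset of `W(ℂ)`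
inside the complex points over the closed `Z ∩ W` of the smooth irreducible affine `W`; hence
`Z ⊇ W`, and a closed subset containing a non-empty open of the irreducible `S` is everything.
[cite: MumfordAV1970, §6, Lemma] -/
theorem eq_univ_of_isClosed_of_interior_nonempty_of_irreducible
    (hM : mumford_smoothCurve_through_two_points) {S : SchemeOver ℂ} [IrreducibleSpace S.left]
    [AlgebraicGeometry.Smooth S.hom] {Z : Set S.left} (hZc : IsClosed Z)
    (hint : (interior {t : ComplexPoints S | t.pt ∈ Z}).Nonempty) : Z = Set.univ := by
  obtain ⟨u, hu⟩ := hint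
  -- an affine open `W ∋ pt u`, as a smooth irreducible affine `ℂ`-scheme
  obtain ⟨W, hW, huW, -⟩ := exists_isAffineOpen_mem_and_subset (U := ⊤) (x := u.pt) trivial
  set g := openSubschemeOverι S W with hg
  haveI : IsOpenImmersion g.left := inferInstanceAs (IsOpenImmersion W.ι)
  haveI hWaff : IsAffine (openSubschemeOver S W).left := hW
  haveI hWirr : IrreducibleSpace (openSubschemeOver S W).left := by
    change IrreducibleSpace W
    exact isIrreducible_iff_irreducibleSpace.mp ⟨⟨u.pt, huW⟩,
      (PreirreducibleSpace.isPreirreducible_univ (X := S.left)).open_subset W.isOpen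
        (Set.subset_univ _)⟩
  haveI hWsm : AlgebraicGeometry.Smooth (openSubschemeOver S W).hom := by
    change AlgebraicGeometry.Smooth (W.ι ≫ S.hom)
    infer_instance
  -- the trace `Z ∩ W` is all of `W`
  have hZW : g.left.base ⁻¹' Z = Set.univ := by
    refine eq_univ_of_isClosed_of_interior_setOf_pt_mem_nonempty hM
      (hZc.preimage g.left.base.hom.continuous) ?_
    -- the preimage of the interior is a non-empty open inside the complex points over `Z ∩ W`
    obtain ⟨u', rfl⟩ : ∃ u' : ComplexPoints (openSubschemeOver S W), AlgPoints.map g u' = u :=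
      ⟨AlgPoints.liftOfMemOpensRange g u ⟨⟨u.pt, huW⟩, rfl⟩, AlgPoints.map_liftOfMemOpensRange g u _⟩
    have hO : IsOpen (AlgPoints.map g ⁻¹' interior {t : ComplexPoints S | t.pt ∈ Z}) :=
      isOpen_interior.preimage (AlgPoints.continuous_map g)
    have hOsub : AlgPoints.map g ⁻¹' interior {t : ComplexPoints S | t.pt ∈ Z} ⊆
        {c : ComplexPoints (openSubschemeOver S W) | c.pt ∈ g.left.base ⁻¹' Z} := fun c hc =>
      (interior_subset (s := {t : ComplexPoints S | t.pt ∈ Z}) hc : (AlgPoints.map g c).pt ∈ Z)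
    exact ⟨u', (hO.subset_interior_iff.2 hOsub) hu⟩
  -- `W ⊆ Z`, so `Z = S`
  have hWZ : (W : Set S.left) ⊆ Z := fun x hx => by
    have : (⟨x, hx⟩ : W) ∈ g.left.base ⁻¹' Z := hZW ▸ Set.mem_univ _
    exact this
  have hdense : Dense (W : Set S.left) := W.isOpen.dense ⟨u.pt, huW⟩
  rw [← Set.univ_subset_iff, ← hdense.closure_eq]
  exact closure_minimal hWZ hZc

/-! ### Smooth irreducible affine bases are thick (Baire) -/

/-- **No set with non-empty analytic interior is covered by countably many proper Zariski-closed
sets of complex points** (smooth irreducible AFFINE `S`, granted Mumford's lemma): `S(ℂ)` is locally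
compact Hausdorff (`locallyCompactSpace_algPoints_holds`, `ComplexPoints.t2Space_of_isSeparated`), hence
a Baire space; the complex points over a proper closed `Zₖ` form a closed set with empty interior
(`interior_setOf_pt_mem_eq_empty_of_ne_univ`), so `⋂ₖ Zₖ(ℂ)ᶜ` is dense and meets the interior of `Λ`.
This is the hypothesis `hΛ` of the closing lemma `variationalHodge_closing_of_thickSet` for such `Λ`.
[cite: MumfordAV1970, §6, Lemma] -/
theorem not_subset_iUnion_of_interior_nonempty (hM : mumford_smoothCurve_through_two_points)
    {S : SchemeOver ℂ} [IsAffine S.left] [IrreducibleSpace S.left] [AlgebraicGeometry.Smooth S.hom]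
    (Λ : Set (ComplexPoints S)) (hΛ : (interior Λ).Nonempty) (Z : ℕ → Set S.left)
    (hZc : ∀ k, IsClosed (Z k)) (hZne : ∀ k, Z k ≠ Set.univ) :
    ¬ Λ ⊆ ⋃ k, {t : ComplexPoints S | t.pt ∈ Z k} := by
  intro hsub
  haveI : IsAffineHom S.hom := inferInstance
  haveI : IsSeparated S.hom := inferInstance
  haveI : T2Space (ComplexPoints S) := ComplexPoints.t2Space_of_isSeparated S
  haveI : LocallyCompactSpace (ComplexPoints S) := locallyCompactSpace_algPoints_holds S ℂ
  -- the complements of the `Zₖ(ℂ)` are open and dense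
  have hopen : ∀ k, IsOpen {t : ComplexPoints S | t.pt ∈ Z k}ᶜ := fun k =>
    (⟨AlgPoints.isOpen_setOf_pt_mem (X := S) (L := ℂ) ⟨(Z k)ᶜ, (hZc k).isOpen_compl⟩⟩ :
      IsClosed {t : ComplexPoints S | t.pt ∈ Z k}).isOpen_compl
  have hdense : ∀ k, Dense {t : ComplexPoints S | t.pt ∈ Z k}ᶜ := fun k => by
    rw [← interior_eq_empty_iff_dense_compl]
    exact interior_setOf_pt_mem_eq_empty_of_ne_univ hM (hZc k) (hZne k)
  have hG : Dense (⋂ k, {t : ComplexPoints S | t.pt ∈ Z k}ᶜ) := dense_iInter_of_isOpen_nat hopen hdense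
  -- a point of the interior of `Λ` off every `Zₖ(ℂ)`
  obtain ⟨x, hxΛ, hxG⟩ := hG.inter_open_nonempty _ isOpen_interior hΛ
  obtain ⟨k, hk⟩ := Set.mem_iUnion.1 (hsub (interior_subset hxΛ))
  exact Set.mem_iInter.1 hxG k hk

/-- **Smooth irreducible affine `ℂ`-schemes are not countable unions of complex-point sets of proper
Zariski-closed subsets** (granted Mumford's lemma) — the hypothesis `hthick` of
`variationalHodge_closing_iff` (`AnchorTransportVariationalHodgeClosing`) DISCHARGED for smooth irreducible
affine bases of any dimension (`AnchorTransportVariationalHodgeCurveThickness` did curves without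
Mumford). [cite: MumfordAV1970, §6, Lemma] -/
theorem univ_not_subset_iUnion (hM : mumford_smoothCurve_through_two_points) {S : SchemeOver ℂ}
    [IsAffine S.left] [IrreducibleSpace S.left] [AlgebraicGeometry.Smooth S.hom] (Z : ℕ → Set S.left)
    (hZc : ∀ k, IsClosed (Z k)) (hZne : ∀ k, Z k ≠ Set.univ) :
    ¬ (Set.univ : Set (ComplexPoints S)) ⊆ ⋃ k, {t : ComplexPoints S | t.pt ∈ Z k} := by
  obtain ⟨u, -⟩ := exists_complexPoints_pt_mem_of_isOpen (S := S) isOpen_univ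
    ⟨IrreducibleSpace.isIrreducible_univ S.left |>.nonempty.some, Set.mem_univ _⟩
  exact not_subset_iUnion_of_interior_nonempty hM Set.univ (by simpa using ⟨u, Set.mem_univ u⟩) Z hZc hZne

end Summit.HodgeConjecture.HodgeConjecture.Theorems

end
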